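import Summits.AtomisticToContinuum.BoseEinsteinCondensation.Theorems.BECSubharmonicContinuationCoreDeficitBounds
import Summits.AtomisticToContinuum.BoseEinsteinCondensation.Theorems.BECSubharmonicContinuationBallCriterion
import Summits.AtomisticToContinuum.BoseEinsteinCondensation.Theorems.BECSubharmonicContinuationContinuationToPeriodicBECSphereKernel
import HarnessLib

/-!
# The sphere-kernel continuation for one trial state
# (route `BECSubharmonicContinuation`, helper for item `ContinuationToPeriodicBEC`, stmt-14585)

Fix `L > 0`, a periodic trial state `Ψ` of `N` bosons, a particle `i`, a core radius
`0 < R ≤ L/2` and write `S = L/2`, `G = G_Ψ(i,·)`, `H = H_Ψ(i,·)` (translation coherence and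
kinetic coherence of the route file), `aₙ = L^{3N}|ĉₙ(Ψ)|²` (`∑ aₙ = 1`) and `κₙ = 2πn(i,·)/L` as in
`…CoreDeficitBounds.lean`. With the SPHERE kernel `W_S(y) = (4π)⁻¹(1/|y| − 1/S)`
(`…SphereKernel.lean`):

1. `∑ₙ aₙ (1 − sinc(|κₙ|S)) = ∫_{B_S} H·W_S` (`hasSum_sphereTotal`; dominated convergence and the
   whole-ball multiplier);
2. `∫_{B_S} H·W_S = ∫_{B_R} H·W_S + ∫_{B_S∖B_R} H·W_S`, the shell part being
   `≤ (4π)⁻¹∫_{R ≤ |y| ≤ S} H₊/|y|` (`0 ≤ W_S ≤ (4π|y|)⁻¹` there) and the core part being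
   `∑ₙ aₙ cₙ` with `|cₙ| ≤ 4 min((|κₙ|R)², 1) ≤ 192 (1 − ∏ⱼ sinc²(κₙ,ⱼR/2))`, i.e.
   `≤ 192 (1 − R⁻³∫ tent_R · G)` (`hasSum_window` of `…CoreDeficitBounds.lean`);
3. the BALL average: `1 − ⨍_{B_S} G = ∑ₙ aₙ (1 − ⨍_{B_S} cos κₙ·y) ≤ 3 ∑ₙ aₙ (1 − sinc(|κₙ|S))`
   (off the zero mode `|κₙ|S = π|n(i,·)| ≥ π`, so `sinc ≤ 1/π ≤ 1/3`, while every ball average of a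
   cosine is `≥ −1`);
4. `BallCriterion` (`ballCriterion_proof`, in the tree): `⨍_{B_{L/2}} G ≥ σ ⇒ n₀ ≥ (2σ − 1)N`.

Conclusion (`condensateOccupation_ge_of_shell_of_window`): if `(4π)⁻¹∫_{R≤|y|≤L/2} H₊/|y| ≤ 1/8`
and `1 − ε ≤ R⁻³∫ tent_R·G` with `192 ε ≤ 1/48`, then `⨍_{B_{L/2}} G ≥ 9/16` and
`condensateOccupation ≥ N/8`. No energy, symmetry or positivity input is used. Folklore
bookkeeping over the tree's momentum representation; no named facts.
-/

noncomputable section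

namespace Summit.AtomisticToContinuum.BoseEinsteinCondensation.Theorems.SubharmonicContinuation

open MeasureTheory Filter Set Metric Real Complex
open scoped ENNReal NNReal ComplexConjugate RealInnerProductSpace
open Literature.MathematicalPhysics.QuantumManyBody.BoseGas

variable {N : ℕ} {L : ℝ}

section Modes

variable {i : Fin N} {κ : (Fin N × Fin 3 → ℤ) → Space}

/-- **`H·W_S` on a concentric ball, mode by mode**: for every radius `ϱ`,
`∫_{B_ϱ} H(y) W_S(y) dy = ∑ₙ aₙ |κₙ|² ∫_{B_ϱ} cos(κₙ·y) W_S(y) dy` (dominated convergence: the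
weights `aₙ|κₙ|²` are summable and `W_S` is integrable on the ball). [folklore] -/
theorem hasSum_integral_ball_H_mul_sphereKernel (hL : 0 < L) (Ψ : PeriodicTrialState N L)
    (hκ : ∀ n k, κ n k = 2 * Real.pi * (n (i, k) : ℝ) / L) (S ϱ : ℝ) :
    HasSum (fun n : Fin N × Fin 3 → ℤ => (L ^ 3) ^ N * ‖configFourierCoeff L Ψ.ψ n‖ ^ 2 *
        (‖κ n‖ ^ 2 * ∫ y in ball (0 : Space) ϱ,
          Real.cos (∑ k, κ n k * y k) * ((4 * π)⁻¹ * (‖y‖⁻¹ - S⁻¹))))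
      (∫ y in ball (0 : Space) ϱ, (∑ k : Fin 3, ∫ X in cellN N L,
        conj (fderiv ℝ Ψ.ψ (Function.update X i (X i + y)) (Pi.single i (EuclideanSpace.single k (1 : ℝ)))) *
          fderiv ℝ Ψ.ψ X (Pi.single i (EuclideanSpace.single k (1 : ℝ)))).re *
        ((4 * π)⁻¹ * (‖y‖⁻¹ - S⁻¹))) := by
  set a : (Fin N × Fin 3 → ℤ) → ℝ := fun n => (L ^ 3) ^ N * ‖configFourierCoeff L Ψ.ψ n‖ ^ 2
    with ha
  have ha0 : ∀ n, 0 ≤ a n := fun n => by rw [ha]; positivity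
  set w : (Fin N × Fin 3 → ℤ) → ℝ := fun n => a n * ‖κ n‖ ^ 2 with hw
  have hw0 : ∀ n, 0 ≤ w n := fun n => by rw [hw]; exact mul_nonneg (ha0 n) (sq_nonneg _)
  have hwsum : Summable w := (CoreDeficitBounds.hasSum_H_zero hL Ψ hκ).summable
  set W : Space → ℝ := fun y => (4 * π)⁻¹ * (‖y‖⁻¹ - S⁻¹) with hW
  have hWi : IntegrableOn W (ball (0 : Space) ϱ) := integrableOn_sphereKernel_ball S ϱ
  have hDC := hasSum_integral_of_dominated_convergence
    (μ := volume.restrict (ball (0 : Space) ϱ))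
    (F := fun n y => w n * Real.cos (∑ k, κ n k * y k) * W y)
    (f := fun y => (∑ k : Fin 3, ∫ X in cellN N L,
        conj (fderiv ℝ Ψ.ψ (Function.update X i (X i + y)) (Pi.single i (EuclideanSpace.single k (1 : ℝ)))) *
          fderiv ℝ Ψ.ψ X (Pi.single i (EuclideanSpace.single k (1 : ℝ)))).re * W y)
    (fun n y => w n * |W y|) (fun n => ?_) (fun n => ?_) ?_ ?_ ?_
  rotate_left
  · -- measurability
    exact (continuous_const.mul (CoreDeficitBounds.continuous_cos_waveVec κ n)).aestronglyMeasurable.mul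
      hWi.aestronglyMeasurable
  · -- domination
    refine ae_of_all _ fun y => ?_
    rw [Real.norm_eq_abs, abs_mul, abs_mul, abs_of_nonneg (hw0 n)]
    exact mul_le_mul_of_nonneg_right (mul_le_of_le_one_right (hw0 n) (Real.abs_cos_le_one _))
      (abs_nonneg _)
  · -- summability of the bound
    exact ae_of_all _ fun y => hwsum.mul_right _
  · -- integrability of the bound
    have h1 : (fun y : Space => ∑' n, w n * |W y|) = fun y => (∑' n, w n) * |W y| := by
      funext y; exact tsum_mul_right
    rw [h1]
    exact hWi.abs.const_mul _
  · -- pointwise convergence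
    exact ae_of_all _ fun y => (CoreDeficitBounds.hasSum_H hL Ψ hκ y).mul_right _
  refine hDC.congr_fun fun n => ?_
  simp only [hw]
  rw [← integral_const_mul, ← integral_const_mul]
  refine integral_congr_ae (ae_of_all _ fun y => ?_)
  simp only [hW]
  ring

/-- **`G` on a ball, mode by mode**: for every radius `ϱ`,
`∫_{B_ϱ} G(y) dy = ∑ₙ aₙ ∫_{B_ϱ} cos(κₙ·y) dy`. [folklore] -/
theorem hasSum_integral_ball_G (hL : 0 < L) (Ψ : PeriodicTrialState N L)
    (hκ : ∀ n k, κ n k = 2 * Real.pi * (n (i, k) : ℝ) / L) (ϱ : ℝ) :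
    HasSum (fun n : Fin N × Fin 3 → ℤ => (L ^ 3) ^ N * ‖configFourierCoeff L Ψ.ψ n‖ ^ 2 *
        ∫ y in ball (0 : Space) ϱ, Real.cos (∑ k, κ n k * y k))
      (∫ y in ball (0 : Space) ϱ,
        (∫ X in cellN N L, conj (Ψ.ψ (Function.update X i (X i + y))) * Ψ.ψ X).re) := by
  set a : (Fin N × Fin 3 → ℤ) → ℝ := fun n => (L ^ 3) ^ N * ‖configFourierCoeff L Ψ.ψ n‖ ^ 2
    with ha
  have ha0 : ∀ n, 0 ≤ a n := fun n => by rw [ha]; positivity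
  have hasum : HasSum a 1 := CoreDeficitBounds.hasSum_coeff hL Ψ
  haveI : IsFiniteMeasure (volume.restrict (ball (0 : Space) ϱ)) :=
    ⟨by rw [Measure.restrict_apply_univ]; exact measure_ball_lt_top⟩
  have hDC := hasSum_integral_of_dominated_convergence
    (μ := volume.restrict (ball (0 : Space) ϱ))
    (F := fun n y => a n * Real.cos (∑ k, κ n k * y k))
    (f := fun y => (∫ X in cellN N L, conj (Ψ.ψ (Function.update X i (X i + y))) * Ψ.ψ X).re)
    (fun n _ => a n) (fun n => ?_) (fun n => ?_) ?_ ?_ ?_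
  rotate_left
  · exact (continuous_const.mul (CoreDeficitBounds.continuous_cos_waveVec κ n)).aestronglyMeasurable
  · refine ae_of_all _ fun y => ?_
    rw [Real.norm_eq_abs, abs_mul, abs_of_nonneg (ha0 n)]
    exact mul_le_of_le_one_right (ha0 n) (Real.abs_cos_le_one _)
  · exact ae_of_all _ fun y => hasum.summable
  · exact integrable_const _
  · exact ae_of_all _ fun y => CoreDeficitBounds.hasSum_G hL Ψ hκ y
  refine hDC.congr_fun fun n => ?_
  rw [← integral_const_mul]

/-- **The sphere identity, summed**: `∫_{B_S} H·W_S = ∑ₙ aₙ (1 − sinc(|κₙ|S))` for `S > 0`.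
[folklore] -/
theorem hasSum_sphereTotal (hL : 0 < L) (Ψ : PeriodicTrialState N L)
    (hκ : ∀ n k, κ n k = 2 * Real.pi * (n (i, k) : ℝ) / L) {S : ℝ} (hS : 0 < S) :
    HasSum (fun n : Fin N × Fin 3 → ℤ => (L ^ 3) ^ N * ‖configFourierCoeff L Ψ.ψ n‖ ^ 2 *
        (1 - Real.sinc (‖κ n‖ * S)))
      (∫ y in ball (0 : Space) S, (∑ k : Fin 3, ∫ X in cellN N L,
        conj (fderiv ℝ Ψ.ψ (Function.update X i (X i + y)) (Pi.single i (EuclideanSpace.single k (1 : ℝ)))) *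
          fderiv ℝ Ψ.ψ X (Pi.single i (EuclideanSpace.single k (1 : ℝ)))).re *
        ((4 * π)⁻¹ * (‖y‖⁻¹ - S⁻¹))) := by
  refine (hasSum_integral_ball_H_mul_sphereKernel hL Ψ hκ S S).congr_fun fun n => ?_
  rw [norm_sq_mul_integral_ball_cos_mul_sphereKernel (κ n) hS]

end Modes

section Main

/-- **The sphere-kernel continuation for one trial state.** For `L > 0`, a periodic trial state
`Ψ` of `N` bosons, a particle `i`, a core radius `0 < R ≤ L/2` and `ε` with `192 ε ≤ 1/48`: if
the shell potential of the positive part of the kinetic coherence is small,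
`(4π)⁻¹∫_{R ≤ |y| ≤ L/2} H₊(y)/|y| dy ≤ 1/8`, and the translate-averaged cube-condensation deficit
of side `R` is at most `ε`, `1 − ε ≤ R⁻³∫ ∏ₖ(1 − |yₖ|/R)₊ G(y) dy`, then the ball average of `G`
over `B(0, L/2)` is at least `9/16`, hence (by `BallCriterion`) `condensateOccupation ≥ N/8`.
[folklore] -/
theorem condensateOccupation_ge_of_shell_of_window (hL : 0 < L) (Ψ : PeriodicTrialState N L)
    (i : Fin N) {R : ℝ} (hR : 0 < R) (hRS : R ≤ L / 2) {ε : ℝ} (hε : 192 * ε ≤ 1 / 48)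
    (hshell : (4 * Real.pi)⁻¹ * (∫ y in {y : Space | R ≤ ‖y‖ ∧ ‖y‖ ≤ L / 2},
      max ((∑ k : Fin 3, ∫ X in cellN N L,
        conj (fderiv ℝ Ψ.ψ (Function.update X i (X i + y)) (Pi.single i (EuclideanSpace.single k (1 : ℝ)))) *
          fderiv ℝ Ψ.ψ X (Pi.single i (EuclideanSpace.single k (1 : ℝ)))).re) 0 / ‖y‖) ≤ 1 / 8)
    (hwin : 1 - ε ≤ R⁻¹ ^ 3 * ∫ y : Space, (∏ k : Fin 3, max (1 - |y k| / R) 0) *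
      (∫ X in cellN N L, conj (Ψ.ψ (Function.update X i (X i + y))) * Ψ.ψ X).re) :
    ENNReal.ofReal (1 / 8 * N) ≤ condensateOccupation N L Ψ.ψ := by
  have hS : 0 < L / 2 := by positivity
  -- the wave vectors `κₙ = 2π n(i,·)/L` and the weights `aₙ`
  set κ : (Fin N × Fin 3 → ℤ) → Space :=
    fun n => WithLp.toLp 2 (fun k : Fin 3 => 2 * Real.pi * (n (i, k) : ℝ) / L) with hκdef
  have hκ : ∀ n k, κ n k = 2 * Real.pi * (n (i, k) : ℝ) / L := fun n k => by
    rw [hκdef, PiLp.toLp_apply]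
  have ha0 : ∀ n : Fin N × Fin 3 → ℤ, 0 ≤ (L ^ 3) ^ N * ‖configFourierCoeff L Ψ.ψ n‖ ^ 2 :=
    fun n => by positivity
  have hasum := CoreDeficitBounds.hasSum_coeff hL Ψ
  have hH := CoreDeficitBounds.hasSum_H hL Ψ hκ
  have hH0 := CoreDeficitBounds.hasSum_H_zero hL Ψ hκ
  have hWd := CoreDeficitBounds.hasSum_window hL Ψ hκ hR
  have hT := hasSum_sphereTotal hL Ψ hκ hS
  have hC := hasSum_integral_ball_H_mul_sphereKernel hL Ψ hκ (L / 2) R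
  have hA := hasSum_integral_ball_G hL Ψ hκ (L / 2)
  ------------------------------------------------------------------
  -- Step 1: the core is at most `192 ε`
  ------------------------------------------------------------------
  have hcore : (∫ y in ball (0 : Space) R, (∑ k : Fin 3, ∫ X in cellN N L,
        conj (fderiv ℝ Ψ.ψ (Function.update X i (X i + y)) (Pi.single i (EuclideanSpace.single k (1 : ℝ)))) *
          fderiv ℝ Ψ.ψ X (Pi.single i (EuclideanSpace.single k (1 : ℝ)))).re *
        ((4 * π)⁻¹ * (‖y‖⁻¹ - (L / 2)⁻¹))) ≤ 192 * ε := by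
    have hcmp := hasSum_le (fun n => ?_) hC ((hasum.sub hWd).mul_left 192)
    · have h1 : 1 - R⁻¹ ^ 3 * ∫ y : Space, (∏ k : Fin 3, max (1 - |y k| / R) 0) *
          (∫ X in cellN N L, conj (Ψ.ψ (Function.update X i (X i + y))) * Ψ.ψ X).re ≤ ε := by
        linarith
      exact hcmp.trans (by nlinarith)
    · have hb := abs_norm_sq_mul_integral_core_le_fejer (κ n) hR hRS
      have hle := (le_abs_self _).trans hb
      calc (L ^ 3) ^ N * ‖configFourierCoeff L Ψ.ψ n‖ ^ 2 *
            (‖κ n‖ ^ 2 * ∫ y in ball (0 : Space) R,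
              Real.cos (∑ k, κ n k * y k) * ((4 * π)⁻¹ * (‖y‖⁻¹ - (L / 2)⁻¹)))
          ≤ (L ^ 3) ^ N * ‖configFourierCoeff L Ψ.ψ n‖ ^ 2 *
            (192 * (1 - ∏ j, Real.sinc (κ n j * R / 2) ^ 2)) :=
            mul_le_mul_of_nonneg_left hle (ha0 n)
        _ = _ := by ring
  ------------------------------------------------------------------
  -- Step 2: `H` is continuous and bounded by `H(0)`
  ------------------------------------------------------------------
  set h0 : ℝ := (∑ k : Fin 3, ∫ X in cellN N L,
        conj (fderiv ℝ Ψ.ψ (Function.update X i (X i + 0)) (Pi.single i (EuclideanSpace.single k (1 : ℝ)))) *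
          fderiv ℝ Ψ.ψ X (Pi.single i (EuclideanSpace.single k (1 : ℝ)))).re with hh0
  have hHcont : Continuous fun y : Space => (∑ k : Fin 3, ∫ X in cellN N L,
        conj (fderiv ℝ Ψ.ψ (Function.update X i (X i + y)) (Pi.single i (EuclideanSpace.single k (1 : ℝ)))) *
          fderiv ℝ Ψ.ψ X (Pi.single i (EuclideanSpace.single k (1 : ℝ)))).re := by
    have hfun : (fun y : Space => (∑ k : Fin 3, ∫ X in cellN N L,
        conj (fderiv ℝ Ψ.ψ (Function.update X i (X i + y)) (Pi.single i (EuclideanSpace.single k (1 : ℝ)))) *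
          fderiv ℝ Ψ.ψ X (Pi.single i (EuclideanSpace.single k (1 : ℝ)))).re) =
        fun y => ∑' n : Fin N × Fin 3 → ℤ, (L ^ 3) ^ N * ‖configFourierCoeff L Ψ.ψ n‖ ^ 2 *
          ‖κ n‖ ^ 2 * Real.cos (∑ k, κ n k * y k) := funext fun y => (hH y).tsum_eq.symm
    rw [hfun]
    refine continuous_tsum (fun n => continuous_const.mul (CoreDeficitBounds.continuous_cos_waveVec κ n))
      hH0.summable fun n y => ?_
    rw [Real.norm_eq_abs, abs_mul, abs_of_nonneg (mul_nonneg (ha0 n) (sq_nonneg _))]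
    exact mul_le_of_le_one_right (mul_nonneg (ha0 n) (sq_nonneg _)) (Real.abs_cos_le_one _)
  have hHbound : ∀ y : Space, |(∑ k : Fin 3, ∫ X in cellN N L,
        conj (fderiv ℝ Ψ.ψ (Function.update X i (X i + y)) (Pi.single i (EuclideanSpace.single k (1 : ℝ)))) *
          fderiv ℝ Ψ.ψ X (Pi.single i (EuclideanSpace.single k (1 : ℝ)))).re| ≤ h0 := by
    intro y
    rw [abs_le]
    constructor
    · have := hasSum_le (fun n => ?_) (hH0.neg) (hH y)
      · simpa using this
      · have h1 := mul_nonneg (ha0 n) (sq_nonneg ‖κ n‖)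
        have h2 := Real.neg_one_le_cos (∑ k, κ n k * y k)
        nlinarith
    · refine hasSum_le (fun n => ?_) (hH y) hH0
      exact mul_le_of_le_one_right (mul_nonneg (ha0 n) (sq_nonneg _)) (Real.cos_le_one _)
  have hh0nn : 0 ≤ h0 := (abs_nonneg _).trans (hHbound 0)
  ------------------------------------------------------------------
  -- Step 3: integrability of `H·W` on the ball and the split at `R`
  ------------------------------------------------------------------
  have hWi : IntegrableOn (fun y : Space => (4 * π)⁻¹ * (‖y‖⁻¹ - (L / 2)⁻¹)) (ball (0 : Space) (L / 2)) :=
    integrableOn_sphereKernel_ball (L / 2) (L / 2)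
  have hint : IntegrableOn (fun y : Space => (∑ k : Fin 3, ∫ X in cellN N L,
        conj (fderiv ℝ Ψ.ψ (Function.update X i (X i + y)) (Pi.single i (EuclideanSpace.single k (1 : ℝ)))) *
          fderiv ℝ Ψ.ψ X (Pi.single i (EuclideanSpace.single k (1 : ℝ)))).re *
        ((4 * π)⁻¹ * (‖y‖⁻¹ - (L / 2)⁻¹))) (ball (0 : Space) (L / 2)) :=
    hWi.bdd_mul hHcont.aestronglyMeasurable (ae_of_all _ fun y => by rw [Real.norm_eq_abs]; exact hHbound y)
  have hsplit := setIntegral_sdiff (μ := (volume : Measure Space)) measurableSet_ball hint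
    (ball_subset_ball hRS)
  ------------------------------------------------------------------
  -- Step 4: the shell is at most `1/8`
  ------------------------------------------------------------------
  have hAset : MeasurableSet {y : Space | R ≤ ‖y‖ ∧ ‖y‖ ≤ L / 2} :=
    (measurableSet_le measurable_const continuous_norm.measurable).inter
      (measurableSet_le continuous_norm.measurable measurable_const)
  have hAfin : volume {y : Space | R ≤ ‖y‖ ∧ ‖y‖ ≤ L / 2} ≠ ⊤ := by
    refine (lt_of_le_of_lt (measure_mono fun y hy => ?_) (measure_closedBall_lt_top (x := (0 : Space))
      (r := L / 2))).ne
    rw [mem_closedBall_zero_iff]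
    exact hy.2
  -- the majorant `g = (4π)⁻¹ H₊/|y|`
  have hgmeas : Measurable fun y : Space => (4 * Real.pi)⁻¹ * (max ((∑ k : Fin 3, ∫ X in cellN N L,
        conj (fderiv ℝ Ψ.ψ (Function.update X i (X i + y)) (Pi.single i (EuclideanSpace.single k (1 : ℝ)))) *
          fderiv ℝ Ψ.ψ X (Pi.single i (EuclideanSpace.single k (1 : ℝ)))).re) 0 / ‖y‖) :=
    ((hHcont.max continuous_const).measurable.div continuous_norm.measurable).const_mul _
  have hgint : IntegrableOn (fun y : Space => (4 * Real.pi)⁻¹ * (max ((∑ k : Fin 3, ∫ X in cellN N L,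
        conj (fderiv ℝ Ψ.ψ (Function.update X i (X i + y)) (Pi.single i (EuclideanSpace.single k (1 : ℝ)))) *
          fderiv ℝ Ψ.ψ X (Pi.single i (EuclideanSpace.single k (1 : ℝ)))).re) 0 / ‖y‖))
      {y : Space | R ≤ ‖y‖ ∧ ‖y‖ ≤ L / 2} := by
    refine Measure.integrableOn_of_bounded (M := (4 * Real.pi)⁻¹ * (h0 / R)) hAfin
      hgmeas.aestronglyMeasurable ?_
    rw [ae_restrict_iff' hAset]
    refine ae_of_all _ fun y hy => ?_
    have hy0 : 0 < ‖y‖ := hR.trans_le hy.1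
    rw [Real.norm_eq_abs, abs_mul, abs_of_nonneg (by positivity : (0 : ℝ) ≤ (4 * Real.pi)⁻¹), abs_div,
      abs_norm, abs_of_nonneg (le_max_right _ _)]
    refine mul_le_mul_of_nonneg_left ?_ (by positivity)
    rw [div_le_div_iff₀ hy0 hR]
    refine mul_le_mul ((max_le (le_abs_self _) (abs_nonneg _)).trans (hHbound y)) hy.1 hR.le hh0nn
  have hshell' : (∫ y in ball (0 : Space) (L / 2) \ ball 0 R, (∑ k : Fin 3, ∫ X in cellN N L,
        conj (fderiv ℝ Ψ.ψ (Function.update X i (X i + y)) (Pi.single i (EuclideanSpace.single k (1 : ℝ)))) *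
          fderiv ℝ Ψ.ψ X (Pi.single i (EuclideanSpace.single k (1 : ℝ)))).re *
        ((4 * π)⁻¹ * (‖y‖⁻¹ - (L / 2)⁻¹))) ≤ 1 / 8 := by
    have hsub : ball (0 : Space) (L / 2) \ ball 0 R ⊆ {y : Space | R ≤ ‖y‖ ∧ ‖y‖ ≤ L / 2} := by
      intro y hy
      rw [Set.mem_sdiff, mem_ball_zero_iff, mem_ball_zero_iff, not_lt] at hy
      exact ⟨hy.2, hy.1.le⟩
    calc (∫ y in ball (0 : Space) (L / 2) \ ball 0 R, (∑ k : Fin 3, ∫ X in cellN N L,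
          conj (fderiv ℝ Ψ.ψ (Function.update X i (X i + y)) (Pi.single i (EuclideanSpace.single k (1 : ℝ)))) *
            fderiv ℝ Ψ.ψ X (Pi.single i (EuclideanSpace.single k (1 : ℝ)))).re *
          ((4 * π)⁻¹ * (‖y‖⁻¹ - (L / 2)⁻¹)))
        ≤ ∫ y in ball (0 : Space) (L / 2) \ ball 0 R, (4 * Real.pi)⁻¹ * (max ((∑ k : Fin 3, ∫ X in cellN N L,
          conj (fderiv ℝ Ψ.ψ (Function.update X i (X i + y)) (Pi.single i (EuclideanSpace.single k (1 : ℝ)))) *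
            fderiv ℝ Ψ.ψ X (Pi.single i (EuclideanSpace.single k (1 : ℝ)))).re) 0 / ‖y‖) := by
          refine setIntegral_mono_on (hint.mono_set sdiff_subset) (hgint.mono_set hsub)
            (measurableSet_ball.diff measurableSet_ball) fun y hy => ?_
          rw [Set.mem_sdiff, mem_ball_zero_iff, mem_ball_zero_iff, not_lt] at hy
          have hy0 : 0 < ‖y‖ := hR.trans_le hy.2
          have hW0 : 0 ≤ (4 * π)⁻¹ * (‖y‖⁻¹ - (L / 2)⁻¹) := sphereKernel_nonneg hy0 hy.1
          have hW1 : (4 * π)⁻¹ * (‖y‖⁻¹ - (L / 2)⁻¹) ≤ (4 * π)⁻¹ * ‖y‖⁻¹ := sphereKernel_le hS.le y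
          calc (∑ k : Fin 3, ∫ X in cellN N L,
                conj (fderiv ℝ Ψ.ψ (Function.update X i (X i + y)) (Pi.single i (EuclideanSpace.single k (1 : ℝ)))) *
                  fderiv ℝ Ψ.ψ X (Pi.single i (EuclideanSpace.single k (1 : ℝ)))).re *
                ((4 * π)⁻¹ * (‖y‖⁻¹ - (L / 2)⁻¹))
              ≤ max ((∑ k : Fin 3, ∫ X in cellN N L,
                conj (fderiv ℝ Ψ.ψ (Function.update X i (X i + y)) (Pi.single i (EuclideanSpace.single k (1 : ℝ)))) *
                  fderiv ℝ Ψ.ψ X (Pi.single i (EuclideanSpace.single k (1 : ℝ)))).re) 0 *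
                ((4 * π)⁻¹ * ‖y‖⁻¹) :=
                (mul_le_mul_of_nonneg_right (le_max_left _ _) hW0).trans
                  (mul_le_mul_of_nonneg_left hW1 (le_max_right _ _))
            _ = (4 * Real.pi)⁻¹ * (max ((∑ k : Fin 3, ∫ X in cellN N L,
                conj (fderiv ℝ Ψ.ψ (Function.update X i (X i + y)) (Pi.single i (EuclideanSpace.single k (1 : ℝ)))) *
                  fderiv ℝ Ψ.ψ X (Pi.single i (EuclideanSpace.single k (1 : ℝ)))).re) 0 / ‖y‖) := by
                rw [div_eq_mul_inv]; ring
      _ ≤ ∫ y in {y : Space | R ≤ ‖y‖ ∧ ‖y‖ ≤ L / 2}, (4 * Real.pi)⁻¹ * (max ((∑ k : Fin 3, ∫ X in cellN N L,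
          conj (fderiv ℝ Ψ.ψ (Function.update X i (X i + y)) (Pi.single i (EuclideanSpace.single k (1 : ℝ)))) *
            fderiv ℝ Ψ.ψ X (Pi.single i (EuclideanSpace.single k (1 : ℝ)))).re) 0 / ‖y‖) := by
          refine setIntegral_mono_set hgint (ae_of_all _ fun y => ?_) (ae_of_all _ hsub)
          exact mul_nonneg (by positivity) (div_nonneg (le_max_right _ _) (norm_nonneg _))
      _ = (4 * Real.pi)⁻¹ * ∫ y in {y : Space | R ≤ ‖y‖ ∧ ‖y‖ ≤ L / 2}, (max ((∑ k : Fin 3, ∫ X in cellN N L,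
          conj (fderiv ℝ Ψ.ψ (Function.update X i (X i + y)) (Pi.single i (EuclideanSpace.single k (1 : ℝ)))) *
            fderiv ℝ Ψ.ψ X (Pi.single i (EuclideanSpace.single k (1 : ℝ)))).re) 0 / ‖y‖) :=
          integral_const_mul _ _
      _ ≤ 1 / 8 := hshell
  ------------------------------------------------------------------
  -- Step 5: the sphere total is at most `192 ε + 1/8`
  ------------------------------------------------------------------
  have htotal : (∫ y in ball (0 : Space) (L / 2), (∑ k : Fin 3, ∫ X in cellN N L,
        conj (fderiv ℝ Ψ.ψ (Function.update X i (X i + y)) (Pi.single i (EuclideanSpace.single k (1 : ℝ)))) *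
          fderiv ℝ Ψ.ψ X (Pi.single i (EuclideanSpace.single k (1 : ℝ)))).re *
        ((4 * π)⁻¹ * (‖y‖⁻¹ - (L / 2)⁻¹))) ≤ 192 * ε + 1 / 8 := by
    linarith [hsplit, hcore, hshell']
  ------------------------------------------------------------------
  -- Step 6: the ball average of `G` is at least `9/16`
  ------------------------------------------------------------------
  set V : ℝ := (volume : Measure Space).real (ball (0 : Space) (L / 2)) with hV
  have hV0 : 0 < V := by
    rw [hV]
    exact ENNReal.toReal_pos (measure_ball_pos volume _ hS).ne' measure_ball_lt_top.ne
  have havg : 1 - V⁻¹ * (∫ y in ball (0 : Space) (L / 2),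
      (∫ X in cellN N L, conj (Ψ.ψ (Function.update X i (X i + y))) * Ψ.ψ X).re) ≤
        3 * ∫ y in ball (0 : Space) (L / 2), (∑ k : Fin 3, ∫ X in cellN N L,
        conj (fderiv ℝ Ψ.ψ (Function.update X i (X i + y)) (Pi.single i (EuclideanSpace.single k (1 : ℝ)))) *
          fderiv ℝ Ψ.ψ X (Pi.single i (EuclideanSpace.single k (1 : ℝ)))).re *
        ((4 * π)⁻¹ * (‖y‖⁻¹ - (L / 2)⁻¹)) := by
    have hL1 : HasSum (fun n : Fin N × Fin 3 → ℤ => (L ^ 3) ^ N * ‖configFourierCoeff L Ψ.ψ n‖ ^ 2 *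
        (1 - V⁻¹ * ∫ y in ball (0 : Space) (L / 2), Real.cos (∑ k, κ n k * y k)))
        (1 - V⁻¹ * ∫ y in ball (0 : Space) (L / 2),
          (∫ X in cellN N L, conj (Ψ.ψ (Function.update X i (X i + y))) * Ψ.ψ X).re) := by
      refine (hasum.sub (hA.mul_left V⁻¹)).congr_fun fun n => ?_
      ring
    refine hasSum_le (fun n => ?_) hL1 (hT.mul_left 3)
    calc (L ^ 3) ^ N * ‖configFourierCoeff L Ψ.ψ n‖ ^ 2 *
          (1 - V⁻¹ * ∫ y in ball (0 : Space) (L / 2), Real.cos (∑ k, κ n k * y k))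
        ≤ (L ^ 3) ^ N * ‖configFourierCoeff L Ψ.ψ n‖ ^ 2 * (3 * (1 - Real.sinc (‖κ n‖ * (L / 2)))) :=
          mul_le_mul_of_nonneg_left (one_sub_ballAverage_le hL hκ n) (ha0 n)
      _ = _ := by ring
  have hσ : (9 : ℝ) / 16 ≤ ⨍ y in ball (0 : Space) (L / 2),
      (∫ X in cellN N L, conj (Ψ.ψ (Function.update X i (X i + y))) * Ψ.ψ X).re := by
    rw [setAverage_eq, smul_eq_mul, ← hV]
    nlinarith [havg, htotal, hε]
  ------------------------------------------------------------------
  -- Step 7: the ball criterion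
  ------------------------------------------------------------------
  have hB := ballCriterion_proof
  unfold Theses.BECSubharmonicContinuation.BallCriterion at hB
  have h := hB N L (9 / 16) hL Ψ i hσ
  have e : (2 * (9 / 16 : ℝ) - 1) * N = 1 / 8 * N := by ring
  rw [e] at h
  exact h

end Main

end Summit.AtomisticToContinuum.BoseEinsteinCondensation.Theorems.SubharmonicContinuation

end
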